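import Literature.AnabelianGeometry.EtaleTheta.Discharge.Sec5SeedsOfDivTransport
import Literature.AnabelianGeometry.EtaleTheta.BiKummerThm44Sub

/-!
# [EtTh] §5, Thm. 5.7 anchor: the seeds producer in the Thm. 4.4 currency of the final knit — "`Ψ` preserves Frobenius-trivial objects" DISCHARGED by T44-L05 (p.329, p.95 / PDF p.103, p.69)

Mochizuki, *The étale theta function …*, Publ. RIMS **45** (2009): proof of Thm. 5.6, p.329 (PDF p.103) "since `Ψ` preserves
pre-steps and Frobenius-trivial objects …"; Thm. 4.4, p.321 (PDF p.95) ll.1–2 "In particular, `Ψ` preserves Frobenius-trivial objects"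
[cite: MochizukiEtTh2009, Thm 5.6 proof p.329 (PDF p.103); Thm 4.4 p.321 (PDF p.95)].

PROOF-ONLY (0 definitions, no new named fact).  abc-iut cell, layer L2, ROWS #14 R232 sequel #2 (abc-iut-w5-d245 gen 4).  The seeds
producer `exists_seeds_hdivcapcup_ofConnectedTemperoidData` (`Sec5SeedsOfDivTransport.lean`, p445769) read with the SAME Thm. 4.4
data `(h44 : Thm44Hyp S S, h3 : PreservesFrobeniusStructure)` that the final knit's FILE 2 `hfam_ofConnectedTemperoidFamily_of_rebase`
(p445776) already carries: its binder `hΨFT` ("`Ψ` preserves Frobenius-trivial objects") IS abc-iut-L2-t3's T44-L05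
`Thm44Hyp.preservesFrobeniusTrivial_of h44 h3` (through the [FrdI] Def. 1.2 (iv) dictionary `PreFrobenioidData.ofFunctor_isFrobeniusTrivial`).
Net residual of {seeds `αs βs`, `hdivcap₁`, `hdivcup₁`} for `Ψ := h44.Ψ`: **`hbs`** (`Ψ(A_1)^bs ≅ A_1^bs`, "characteristic", p.329 l.5)
and **`hdivA`** (the `β`-free divisor transport = Prop. 5.3 (vi) read at `A_1`) — beyond `h44`/`h3`, which the knit holds anyway.
HONEST FRAMING: kernel-checked implication about the §5 data; nothing asserted for an actual curve; typed ≠ discharged; no side taken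
on [IUTchIII] Cor. 3.12.
-/

namespace Literature.AnabelianGeometry.EtaleTheta

open CategoryTheory Opposite Literature.AlgebraicGeometry.Frobenioids Literature.AnabelianGeometry.SemiGraphs
  Literature.AnabelianGeometry.SemiGraphs.GaloisObjects FrobenioidCyclotomicRigidity

universe u₀ v₀ w₀

namespace ThetaFrobenioid

variable {K : Type u₀} [Field K] {X : SemiGraphs.TemperedArithmeticGroup.{u₀} K} {D₀ : Type u₀} [Category.{v₀} D₀]
  {V : FrdIMonoidStub.{w₀}} {T₀ : RealifiedDivisorMonoids (D₀ := D₀) V}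
  {VD : FrdICatStub.{u₀ + 1, u₀, w₀} (ConnectedPart (BTemp X.Pi))}
  {tf : TemperedFrobenioid T₀ (ConnectedPart (BTemp X.Pi)) VD} {hZ : tf.monoidType = MonoidType.Z}
  {hP : ∀ A : (ConnectedPart (BTemp X.Pi))ᵒᵖ, IsPerfect (tf.Φ.carrier A)}
  {NH : Subgroup (Field.absoluteGaloisGroup K) → tf.category → ℕ+ → Prop} {A₀ : tf.category}
  {hA₀ : PreFrobenioid.IsFrobeniusTrivial tf.toElem A₀} {hA₀' : SemiGraphs.IsGaloisObj A₀.base.obj}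
  {lv N : ℕ+} {T : ThetaEnvData.{max u₀ w₀} N}
  {pullFrac : ∀ {A A' : (BiKummerSetting.mkOfConnectedTemperoid X tf hZ hP NH A₀ hA₀ hA₀').C} (_ : A' ⟶ A),
    (BiKummerSetting.mkOfConnectedTemperoid X tf hZ hP NH A₀ hA₀ hA₀').biratUnits A →
      (BiKummerSetting.mkOfConnectedTemperoid X tf hZ hP NH A₀ hA₀ hA₀').biratUnits A'}
  {θ : (BiKummerSetting.mkOfConnectedTemperoid X tf hZ hP NH A₀ hA₀ hA₀').biratUnits
    (BiKummerSetting.mkOfConnectedTemperoid X tf hZ hP NH A₀ hA₀ hA₀').Aodot}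
  {Bl : (BiKummerSetting.mkOfConnectedTemperoid X tf hZ hP NH A₀ hA₀ hA₀').C}
  {Pl : (BiKummerSetting.mkOfConnectedTemperoid X tf hZ hP NH A₀ hA₀ hA₀').FractionPair θ Bl}
  {Rl : (BiKummerSetting.mkOfConnectedTemperoid X tf hZ hP NH A₀ hA₀ hA₀').NthRoot θ Pl lv pullFrac}
  (h : ModelFrobenioid.Hypotheses tf.divisorMonoid tf.ratFnFunctor)
  (Q : FrobenioidTheta.ThetaSubquotientStub.{w₀} (ConnectedPart (BTemp X.Pi))) (odd_l : Odd (lv : ℕ))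
  (R : (BiKummerSetting.mkOfConnectedTemperoid X tf hZ hP NH A₀ hA₀ hA₀').NthRoot Rl.root Rl.pair N pullFrac)
  (ιX : T.PiX ≃ₜ* X.Pi) (K' : Type w₀) [Field K'] (constEmb : K'ˣ →* tf.biratUnitsModel R.BN)
  (constEmb_injective : Function.Injective constEmb)
  (hinvc : ∀ g : Aut R.AN.base,
    pull tf.divisorMonoid g.hom (ModelFrobenioid.div R.pair.num) = ModelFrobenioid.div R.pair.num)
  (hinvp : ∀ y : T.PiX, y ∈ T.PiYdd →
    pull tf.divisorMonoid ((BiKummerSetting.mkOfConnectedTemperoid X tf hZ hP NH A₀ hA₀ hA₀').galoisSurj R.AN.base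
      R.αData.isGalois (ιX y)).hom (ModelFrobenioid.div R.pair.den) = ModelFrobenioid.div R.pair.den)
  (h44 : BiKummerSetting.Thm44Hyp (BiKummerSetting.mkOfConnectedTemperoid X tf hZ hP NH A₀ hA₀ hA₀')
    (BiKummerSetting.mkOfConnectedTemperoid X tf hZ hP NH A₀ hA₀ hA₀'))

/-- **"`Ψ` preserves Frobenius-trivial objects" at the genuine §5 data, from the Thm. 4.4 data** (T44-L05,
`Thm44Hyp.preservesFrobeniusTrivial_of`), in the `PreFrobenioidData.PreservesObj` currency of the Thm. 5.10 (i) / seeds files.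
[cite: MochizukiEtTh2009, Thm 4.4 p.321 (PDF p.95); Thm 5.6 proof p.329 (PDF p.103)] -/
theorem preservesFrobeniusTrivial_ofConnectedTemperoidData_of_thm44 (h3 : h44.PreservesFrobeniusStructure) :
    PreFrobenioidData.PreservesObj h44.Ψ.functor
      (ofConnectedTemperoidData h Q odd_l R ιX K' constEmb constEmb_injective hinvc hinvp).pre.IsFrobeniusTrivial
      (ofConnectedTemperoidData h Q odd_l R ιX K' constEmb constEmb_injective hinvc hinvp).pre.IsFrobeniusTrivial :=
  fun A hA => (PreFrobenioidData.ofFunctor_isFrobeniusTrivial _ _).mpr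
    (h44.preservesFrobeniusTrivial_of h3 A ((PreFrobenioidData.ofFunctor_isFrobeniusTrivial _ _).mp hA))

/-- **The seeds `αs, βs` and `hdivcap₁`/`hdivcup₁` of the anchored capstone for `Ψ := h44.Ψ`, from `h3`, `hbs`, `hdivA`** —
`exists_seeds_hdivcapcup_ofConnectedTemperoidData` with `hΨFT` DISCHARGED by T44-L05; residual: `hbs` (`Ψ(A_N)^bs ≅ A_N^bs`,
"characteristic") and `hdivA` (Prop. 5.3 (vi) read at `A_N`, `β`-free).
[cite: MochizukiEtTh2009, Thm 5.6 proof p.329 (PDF p.103); Thm 5.10 (i) p.333 (PDF p.107); Thm 4.4 p.321 (PDF p.95)] -/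
theorem exists_seeds_hdivcapcup_ofConnectedTemperoidData_of_thm44 (h3 : h44.PreservesFrobeniusStructure)
    (hbs : (ofConnectedTemperoidData h Q odd_l R ιX K' constEmb constEmb_injective hinvc hinvp).pre.BaseIsomorphic
      (h44.Ψ.functor.obj (ofConnectedTemperoidData h Q odd_l R ιX K' constEmb constEmb_injective hinvc hinvp).AN)
      (ofConnectedTemperoidData h Q odd_l R ιX K' constEmb constEmb_injective hinvc hinvp).AN)
    (hdivA : ∀ α : h44.Ψ.functor.obj (ofConnectedTemperoidData h Q odd_l R ιX K' constEmb constEmb_injective hinvc hinvp).AN ≅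
        (ofConnectedTemperoidData h Q odd_l R ιX K' constEmb constEmb_injective hinvc hinvp).AN,
      ∃ ε : Aut (ofConnectedTemperoidData h Q odd_l R ιX K' constEmb constEmb_injective hinvc hinvp).AN,
        (ofConnectedTemperoidData h Q odd_l R ιX K' constEmb constEmb_injective hinvc hinvp).pre.div
            (α.inv ≫ h44.Ψ.functor.map (ofConnectedTemperoidData h Q odd_l R ιX K' constEmb constEmb_injective hinvc hinvp).sCap) =
          (ofConnectedTemperoidData h Q odd_l R ιX K' constEmb constEmb_injective hinvc hinvp).pre.div
            (ε.hom ≫ (ofConnectedTemperoidData h Q odd_l R ιX K' constEmb constEmb_injective hinvc hinvp).sCap) ∧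
        (ofConnectedTemperoidData h Q odd_l R ιX K' constEmb constEmb_injective hinvc hinvp).pre.div
            (α.inv ≫ h44.Ψ.functor.map (ofConnectedTemperoidData h Q odd_l R ιX K' constEmb constEmb_injective hinvc hinvp).sCup) =
          (ofConnectedTemperoidData h Q odd_l R ιX K' constEmb constEmb_injective hinvc hinvp).pre.div
            (ε.hom ≫ (ofConnectedTemperoidData h Q odd_l R ιX K' constEmb constEmb_injective hinvc hinvp).sCup)) :
    ∃ (αs : h44.Ψ.functor.obj (ofConnectedTemperoidData h Q odd_l R ιX K' constEmb constEmb_injective hinvc hinvp).AN ≅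
        (ofConnectedTemperoidData h Q odd_l R ιX K' constEmb constEmb_injective hinvc hinvp).AN)
      (βs : h44.Ψ.functor.obj (ofConnectedTemperoidData h Q odd_l R ιX K' constEmb constEmb_injective hinvc hinvp).BN ≅
        (ofConnectedTemperoidData h Q odd_l R ιX K' constEmb constEmb_injective hinvc hinvp).BN),
      αs.inv ≫ h44.Ψ.functor.map (ofConnectedTemperoidData h Q odd_l R ιX K' constEmb constEmb_injective hinvc hinvp).sCap ≫ βs.hom =
        (ofConnectedTemperoidData h Q odd_l R ιX K' constEmb constEmb_injective hinvc hinvp).sCap ∧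
      (ofConnectedTemperoidData h Q odd_l R ιX K' constEmb constEmb_injective hinvc hinvp).pre.div
          (αs.inv ≫ h44.Ψ.functor.map (ofConnectedTemperoidData h Q odd_l R ιX K' constEmb constEmb_injective hinvc hinvp).sCap ≫
            βs.hom) =
        (ofConnectedTemperoidData h Q odd_l R ιX K' constEmb constEmb_injective hinvc hinvp).pre.div
          (ofConnectedTemperoidData h Q odd_l R ιX K' constEmb constEmb_injective hinvc hinvp).sCap ∧
      (ofConnectedTemperoidData h Q odd_l R ιX K' constEmb constEmb_injective hinvc hinvp).pre.div
          (αs.inv ≫ h44.Ψ.functor.map (ofConnectedTemperoidData h Q odd_l R ιX K' constEmb constEmb_injective hinvc hinvp).sCup ≫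
            βs.hom) =
        (ofConnectedTemperoidData h Q odd_l R ιX K' constEmb constEmb_injective hinvc hinvp).pre.div
          (ofConnectedTemperoidData h Q odd_l R ιX K' constEmb constEmb_injective hinvc hinvp).sCup :=
  exists_seeds_hdivcapcup_ofConnectedTemperoidData h Q odd_l R ιX K' constEmb constEmb_injective hinvc hinvp h44.Ψ
    (preservesFrobeniusTrivial_ofConnectedTemperoidData_of_thm44 h Q odd_l R ιX K' constEmb constEmb_injective hinvc hinvp h44 h3)
    hbs hdivA

end ThetaFrobenioid

end Literature.AnabelianGeometry.EtaleTheta
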